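import Summits.NavierStokesRegularity.NavierStokesRegularity.Theses.WeakLambdaEndpoint
import Summits.NavierStokesRegularity.NavierStokesRegularity.Theorems.ContinuousAlignmentCriterion.Negative.FalseWithoutLerayHopf
import Literature.Analysis.FunctionSpaces.LittlewoodPaleyHolderDirect

/-!
# `WeakLambdaCriterion` (stmt-NavierStokesRegularity-19625): the Leray–Hopf hypothesis is load-bearing,
and the dissipation-wavenumber hypothesis is blind to the zero mode

Negative-side support for the crux `WeakLambdaEndpoint.WeakLambdaCriterion` (route
`WeakLambdaEndpoint`, X1 = the Cheskidov–Shvydkoy criterion at the weak-`L^{5/2}` endpoint),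
refuter crux-attack at birth, 2026-08-17.

LOAD-BEARING ANALYSIS. The statement negated in `weakLambdaCriterion_false_without_lerayHopf` is the crux with
the single hypothesis `IsLerayHopfOn T ν 0 (u 0) u` deleted and every other clause verbatim (checked by the closing `example`,
which re-inserts the binder and recovers the route decl by `exact`). It is FALSE
(`weakLambdaCriterion_false_without_lerayHopf`), for EVERY threshold `c₀ > 0`: the pressure-driven
spatially constant runaway `u(t,x) = ((1−t)⁻¹ − 1) e₀`, `p(t,x) = −(1−t)⁻² ⟪e₀, x⟫` of the tree
(`ContinuousAlignmentCriterion.Negative.uW/pW`: an exact classical solution on `[0,1) × ℝ³` with zero datum and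
no classical continuation past `t = 1`) has ALL Littlewood–Paley blocks zero at every time
(`blockFn_const_eq_zero`: `Δ̇_j c = (∫ K_j) • c = 0`, the kernels have mean zero), so every saturation set
`{t | ∃ j > n, c₀ν2^j ≤ ‖Δ̇_j u(t)‖_∞}` is EMPTY and the weak-`L^{5/2}` bound holds with `A = 0`.
Consequences for provers: (i) any proof of X1 must use the finite-energy (Leray–Hopf) class; (ii) the
dissipation wavenumber `Λ_{c₀}` sees neither Galilean drifts nor accelerated frames (the `ξ = 0` mode), so
every estimate converting the `Λ`-clock into pointwise control of `u` must import the low modes from the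
energy class (as in Cheskidov–Shvydkoy 2011, Lemma 4.1, where Bernstein + `‖u_q‖₂ ≤ E^{1/2}` is used).
[folklore]
-/

noncomputable section

-- the summit and its single sub-problem share the name (CONVENTIONS §1), as in every Theorems file
set_option linter.dupNamespace false

namespace Summit.NavierStokesRegularity.NavierStokesRegularity.Theorems.WeakLambdaCriterion.Negative

open MeasureTheory Set Function
open scoped InnerProductSpace RealInnerProductSpace ENNReal
open Literature.Analysis.FluidPDE Literature.Analysis.FunctionSpaces
open Summit.NavierStokesRegularity.NavierStokesRegularity.Theorems.ContinuousAlignmentCriterion.Negative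
  (E3 e0 amp uW pW isClassicalNSSolutionOn_uW hasRapidSpatialDecay_uW_zero not_hasSmoothExtensionPast_uW)

/-! ## The Littlewood–Paley blocks annihilate constants -/

/-- **`Δ̇_j c = 0` for a constant field** (`(K_j ⋆ c)(x) = (∫ K_j) • c` and `∫ K_j = φ_j(0) = 0`,
`integral_blockKernel_mul_prod_inner_eq_zero` with no factors). [folklore] -/
theorem blockFn_const_eq_zero (j : ℤ) (c : E3) : blockFn j (fun _ : E3 => c) = 0 := by
  funext x
  rw [blockFn_apply, Pi.zero_apply, integral_smul_const]
  have h := integral_blockKernel_mul_prod_inner_eq_zero (E := E3) j 0 (fun _ => 0)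
  simp only [Finset.univ_eq_empty, Finset.prod_empty, mul_one] at h
  rw [h, zero_smul]

/-- Every block of every slice of the runaway vanishes: `Δ̇_j (uW t) = 0`. -/
theorem blockFn_uW (j : ℤ) (t : ℝ) : blockFn j (uW t) = 0 :=
  blockFn_const_eq_zero j (amp t • e0)

/-- Hence the saturation sets of the runaway are empty at every level `n`, for every threshold
`c₀ν > 0` and every `T`. -/
theorem saturatedSet_uW_eq_empty {c₀ ν : ℝ} (hc : 0 < c₀ * ν) (T : ℝ) (n : ℕ) :
    {t ∈ Set.Ioo (0 : ℝ) T | ∃ j : ℕ, n < j ∧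
        ENNReal.ofReal (c₀ * ν) * 2 ^ j ≤ eLpNorm (blockFn (j : ℤ) (uW t)) ⊤ volume} = ∅ := by
  ext t
  simp only [mem_setOf_eq, mem_empty_iff_false, iff_false, not_and, not_exists]
  intro _ j _ hle
  rw [blockFn_uW, eLpNorm_zero, nonpos_iff_eq_zero, mul_eq_zero] at hle
  rcases hle with h | h
  · exact absurd h (by simpa using hc)
  · exact absurd h (by simp)

/-- … so the weak-`L^{5/2}` dissipation-wavenumber bound holds for the runaway with `A = 0`. -/
theorem weakLambdaBound_uW {c₀ ν : ℝ} (hc : 0 < c₀ * ν) (T : ℝ) :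
    ∃ A : NNReal, ∀ n : ℕ, (2 : ENNReal) ^ (5 * n) *
      volume {t ∈ Set.Ioo (0 : ℝ) T | ∃ j : ℕ, n < j ∧
        ENNReal.ofReal (c₀ * ν) * 2 ^ j ≤ eLpNorm (blockFn (j : ℤ) (uW t)) ⊤ volume} ^ 2 ≤
      (A : ENNReal) :=
  ⟨0, fun n => by rw [saturatedSet_uW_eq_empty hc T n]; simp⟩

/-! ## The mutated statement (Leray–Hopf hypothesis deleted, all else verbatim) is false -/

/-- **`WeakLambdaCriterion` is FALSE without the Leray–Hopf hypothesis, at every threshold `c₀ > 0`.**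
Witness: `ν = 1`, `T = 1`, the runaway `(uW, pW)`; its `Λ`-hypothesis holds with `A = 0`
(`weakLambdaBound_uW`) and it has no classical continuation past `1`
(`not_hasSmoothExtensionPast_uW`). So any proof of the crux must use the finite-energy class. [folklore] -/
theorem weakLambdaCriterion_false_without_lerayHopf :
    ¬ (∃ c₀ : ℝ, 0 < c₀ ∧ ∀ (ν T : ℝ), 0 < ν → 0 < T →
        ∀ (u : ℝ → EuclideanSpace ℝ (Fin 3) → EuclideanSpace ℝ (Fin 3))
          (p : ℝ → EuclideanSpace ℝ (Fin 3) → ℝ),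
          Literature.Analysis.FluidPDE.IsClassicalNSSolutionOn (Set.Ico 0 T) ν 0 u p →
          Literature.Analysis.FluidPDE.HasRapidSpatialDecay (u 0) →
          (∃ A : NNReal, ∀ n : ℕ, (2 : ENNReal) ^ (5 * n) *
            MeasureTheory.volume {t ∈ Set.Ioo 0 T | ∃ j : ℕ, n < j ∧
              ENNReal.ofReal (c₀ * ν) * 2 ^ j ≤
                MeasureTheory.eLpNorm (Literature.Analysis.FunctionSpaces.blockFn (j : ℤ) (u t)) ⊤
                  MeasureTheory.volume} ^ 2 ≤ (A : ENNReal)) →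
          Literature.Analysis.FluidPDE.HasSmoothExtensionPast ν 0 u T) := by
  rintro ⟨c₀, hc₀, h⟩
  exact not_hasSmoothExtensionPast_uW 1
    (h 1 1 one_pos one_pos uW pW (isClassicalNSSolutionOn_uW 1) hasRapidSpatialDecay_uW_zero
      (weakLambdaBound_uW (by simpa using hc₀) 1))

-- Sanity check of the mutation (not a declaration): re-inserting the Leray–Hopf hypothesis (as an ignored
-- binder) into the statement negated above gives back the crux VERBATIM — this `example`
-- type-checks only if every other clause agrees with the route decl symbol by symbol.
example
    (h : ∃ c₀ : ℝ, 0 < c₀ ∧ ∀ (ν T : ℝ), 0 < ν → 0 < T →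
          ∀ (u : ℝ → EuclideanSpace ℝ (Fin 3) → EuclideanSpace ℝ (Fin 3))
            (p : ℝ → EuclideanSpace ℝ (Fin 3) → ℝ),
            Literature.Analysis.FluidPDE.IsClassicalNSSolutionOn (Set.Ico 0 T) ν 0 u p →
            Literature.Analysis.FluidPDE.HasRapidSpatialDecay (u 0) →
            (∃ A : NNReal, ∀ n : ℕ, (2 : ENNReal) ^ (5 * n) *
              MeasureTheory.volume {t ∈ Set.Ioo 0 T | ∃ j : ℕ, n < j ∧
                ENNReal.ofReal (c₀ * ν) * 2 ^ j ≤
                  MeasureTheory.eLpNorm (Literature.Analysis.FunctionSpaces.blockFn (j : ℤ) (u t)) ⊤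
                    MeasureTheory.volume} ^ 2 ≤ (A : ENNReal)) →
            Literature.Analysis.FluidPDE.HasSmoothExtensionPast ν 0 u T) :
    Summit.NavierStokesRegularity.NavierStokesRegularity.Theses.WeakLambdaEndpoint.WeakLambdaCriterion := by
  obtain ⟨c₀, hc₀, h⟩ := h
  exact ⟨c₀, hc₀, fun ν T hν hT u p hcl _ hdec hΛ => h ν T hν hT u p hcl hdec hΛ⟩

end Summit.NavierStokesRegularity.NavierStokesRegularity.Theorems.WeakLambdaCriterion.Negative

end
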